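import Summits.CriticalPhenomena.PercolationContinuityZ3.Theorems.Transplant.FKConnectivityAllQForestSeparatorGlueRankOne
import HarnessLib

/-!
# The path gadget: the two elementary moves (validity of the re-glued classes)

builds on p205010 (kernel theorem, internal audit signed; external expert review pending).  No definitions, no named facts, no sorries;
standard axioms.

Separator `S = {o, p, q}` whose gadget is the PATH `{op, oq}`; sides `E₁` (on `V₁`), `E₂` (on `V₂`), `V₁ ∩ V₂ ⊆ S`, `E₁ ∩ E₂ = ∅`,
no side pair inside `S` (memo bschramm/FROM-fk-1-g20-SEPARATOR-EXCHANGE.md §3).  For two complementary classes `X, Y` (both forests) the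
involution `Ψ` of `…PathGadgetTransfer` re-glues `(X ∩ E₁) ∪ gadget' ∪ (Y ∩ E₂)`; this file proves the two validity statements it
needs, by the rank-one gluing lemma of `…GlueRankOne` and free gluing:
* `pathGadget_moveGen` — `X` holds both gadget pairs (its side traces are discrete), `oc` leaves it: `(X₁ ∪ {oc'}) ∪ Y₂` and
  `(Y₁ ∪ {oc}) ∪ X₂` are forests as soon as `Y₁` does not join `o, c` and `Y₂` does not join `o, c'`;
* `pathGadget_moveFull` — `X` receives the whole path: `(X₁ ∪ {op, oq}) ∪ Y₂` and `Y₁ ∪ X₂` are forests when `X₁, Y₂` are discrete on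
  `S`, `X₂` does not join `o, c`, `Y₁` does not join `o, c'`, and `c, c'` are not joined in both `X₂` and `Y₁`;
* `symmDiff_toggle_subset`, `gadget_toggle_subset`, `isForestCfg_toggle_of_glued` — bookkeeping: the toggled colouring
  `ω ∆ ((M' ∩ E₂) ∪ G)` lies inside the re-glued union, so its validity follows from the glued one.
[cite: Grimmett2006, §1.5 (p. 13); §3.8 (pp. 61–62); §4.2 Lemma (4.13)]
-/

noncomputable section

namespace Summit.CriticalPhenomena.PercolationContinuityZ3.Theorems

namespace FK

open Set SimpleGraph Literature.Probability.LatticeModels Literature.Probability.Percolation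
open scoped Classical

variable {V : Type*} [Fintype V]

section PathGadgetMoves

open scoped symmDiff

variable {E₁ E₂ : Set (Sym2 V)} {V₁ V₂ : Set V} {o p q : V}

omit [Fintype V] in
/-- Where a toggled colouring lives: for `K = (M' ∩ E₂) ∪ G` with `G` inside the gadget `ES`,
`ω ∆ K ⊆ (ω ∩ E₁ ∪ (ω ∆ G) ∩ ES) ∪ (ω ∆ M') ∩ E₂`. [folklore] -/
theorem symmDiff_toggle_subset {ES : Set (Sym2 V)} {M' ω G : BondConfig V} (hM' : M' ⊆ ES ∪ (E₁ ∪ E₂))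
    (hω : ω ⊆ ES ∪ (E₁ ∪ E₂)) (hG : G ⊆ ES) (hd₁ : Disjoint ES E₁) (hd₂ : Disjoint ES E₂) (hd : Disjoint E₁ E₂) :
    ω ∆ (M' ∩ E₂ ∪ G) ⊆ (ω ∩ E₁ ∪ (ω ∆ G) ∩ ES) ∪ (ω ∆ M') ∩ E₂ := by
  intro x hx
  have hxU : x ∈ ES ∪ (E₁ ∪ E₂) := by
    rcases Set.mem_symmDiff.1 hx with ⟨h, -⟩ | ⟨h, -⟩
    · exact hω h
    · rcases h with h | h
      · exact hM' h.1
      · exact Or.inl (hG h)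
  rcases hxU with hxS | hx1 | hx2
  · -- a gadget pair: membership in `ω ∆ K` is membership in `ω ∆ G`
    have hxE₂ : x ∉ E₂ := fun h => Set.disjoint_left.1 hd₂ hxS h
    refine Or.inl (Or.inr ⟨?_, hxS⟩)
    rcases Set.mem_symmDiff.1 hx with ⟨h1, h2⟩ | ⟨h1, h2⟩
    · exact Set.mem_symmDiff.2 (Or.inl ⟨h1, fun h => h2 (Or.inr h)⟩)
    · rcases h1 with h1 | h1
      · exact absurd h1.2 hxE₂
      · exact Set.mem_symmDiff.2 (Or.inr ⟨h1, h2⟩)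
  · -- a side-1 pair: untouched
    have hxK : x ∉ M' ∩ E₂ ∪ G := by
      rintro (h | h)
      · exact Set.disjoint_left.1 hd hx1 h.2
      · exact Set.disjoint_left.1 hd₁ (hG h) hx1
    refine Or.inl (Or.inl ⟨?_, hx1⟩)
    rcases Set.mem_symmDiff.1 hx with ⟨h1, -⟩ | ⟨h1, -⟩
    · exact h1
    · exact absurd h1 hxK
  · -- a side-2 pair: toggled exactly when free
    refine Or.inr ⟨?_, hx2⟩
    have hxG : x ∉ G := fun h => Set.disjoint_left.1 hd₂ (hG h) hx2
    rcases Set.mem_symmDiff.1 hx with ⟨h1, h2⟩ | ⟨h1, h2⟩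
    · exact Set.mem_symmDiff.2 (Or.inl ⟨h1, fun h => h2 (Or.inl ⟨h, hx2⟩)⟩)
    · rcases h1 with h1 | h1
      · exact Set.mem_symmDiff.2 (Or.inr ⟨h1.1, h2⟩)
      · exact absurd h1 hxG

omit [Fintype V] in
/-- The gadget part after toggling one of the two gadget pairs. [folklore] -/
theorem gadget_toggle_subset {ES : Set (Sym2 V)} {X : BondConfig V} {g g' : Sym2 V} (hESgg : ES = {g, g'} ∨ ES = {g', g})
    (hgg : g ≠ g') :
    (g ∈ X → (X ∆ {g}) ∩ ES ⊆ {x | x = g' ∧ g' ∈ X}) ∧ (g ∉ X → (X ∆ {g}) ∩ ES ⊆ insert g {x | x = g' ∧ g' ∈ X}) := by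
  have memES : ∀ x ∈ ES, x = g ∨ x = g' := by
    intro x hx
    rcases hESgg with h | h <;> rw [h] at hx <;> rcases hx with rfl | hx
    · exact Or.inl rfl
    · exact Or.inr (mem_singleton_iff.1 hx)
    · exact Or.inr rfl
    · exact Or.inl (mem_singleton_iff.1 hx)
  constructor
  · intro hgX x ⟨hx, hxES⟩
    rcases memES x hxES with rfl | rfl
    · exact absurd ((mem_symmDiff_iff_of_mem (mem_singleton _)).1 hx) (not_not.2 hgX)
    · exact ⟨rfl, (mem_symmDiff_iff_of_notMem (fun h => hgg (mem_singleton_iff.1 h).symm)).1 hx⟩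
  · intro _ x ⟨hx, hxES⟩
    rcases memES x hxES with rfl | rfl
    · exact mem_insert _ _
    · exact mem_insert_of_mem _ ⟨rfl, (mem_symmDiff_iff_of_notMem (fun h => hgg (mem_singleton_iff.1 h).symm)).1 hx⟩

omit [Fintype V] in
/-- **Validity of a toggle from validity of the re-glued unions**: with `K = (M' ∩ E₂) ∪ G` (`G` gadget pairs), if the re-glued
classes `ω₁ ∪ GA ∪ (ω ∆ M')₂` and `(ω ∆ M')₁ ∪ GB ∪ ω₂` are forests and contain the new gadget parts, then `ω ∆ K` and `(ω ∆ K) ∆ M'`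
are forests. [cite: Grimmett2006, §1.5 (p. 13)] -/
theorem isForestCfg_toggle_of_glued {ES : Set (Sym2 V)} {M' ω : BondConfig V} (hM'sub : M' ⊆ ES ∪ (E₁ ∪ E₂))
    (hωsub : ω ⊆ ES ∪ (E₁ ∪ E₂)) (hES₁ : Disjoint ES E₁) (hES₂ : Disjoint ES E₂) (hd : Disjoint E₁ E₂)
    (G : Set (Sym2 V)) (hG : G ⊆ ES) {GA GB : Set (Sym2 V)}
    (hA : (ω ∆ G) ∩ ES ⊆ GA) (hB : ((ω ∆ M') ∆ G) ∩ ES ⊆ GB)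
    (hFA : IsForestCfg (ω ∩ E₁ ∪ GA ∪ (ω ∆ M') ∩ E₂)) (hFB' : IsForestCfg ((ω ∆ M') ∩ E₁ ∪ GB ∪ ω ∩ E₂)) :
    IsForestCfg (ω ∆ (M' ∩ E₂ ∪ G)) ∧ IsForestCfg ((ω ∆ (M' ∩ E₂ ∪ G)) ∆ M') := by
  have hωBsub : ω ∆ M' ⊆ ES ∪ (E₁ ∪ E₂) := by
    intro x hx
    rcases Set.mem_symmDiff.1 hx with ⟨hx, -⟩ | ⟨hx, -⟩
    · exact hωsub hx
    · exact hM'sub hx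
  constructor
  · refine isForestCfg_of_subset hFA fun x hx => ?_
    rcases symmDiff_toggle_subset (E₁ := E₁) (E₂ := E₂) hM'sub hωsub hG hES₁ hES₂ hd hx with (hx | hx) | hx
    · exact Or.inl (Or.inl hx)
    · exact Or.inl (Or.inr (hA hx))
    · exact Or.inr hx
  · have hrew : (ω ∆ (M' ∩ E₂ ∪ G)) ∆ M' = (ω ∆ M') ∆ (M' ∩ E₂ ∪ G) := by
      rw [symmDiff_assoc, symmDiff_comm (M' ∩ E₂ ∪ G) M', ← symmDiff_assoc]
    rw [hrew]
    refine isForestCfg_of_subset hFB' fun x hx => ?_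
    rcases symmDiff_toggle_subset (E₁ := E₁) (E₂ := E₂) hM'sub hωBsub hG hES₁ hES₂ hd hx with (hx | hx) | hx
    · exact Or.inl (Or.inl hx)
    · exact Or.inl (Or.inr (hB hx))
    · rw [symmDiff_symmDiff_cancel_right] at hx; exact Or.inr hx

/-- **Move `oc` out of the class holding the whole path** (`X ⊇ {oc, oc'}`, so `X₁, X₂` are discrete on `S`): the re-glued classes
`(X₁ ∪ {oc'}) ∪ Y₂` and `(Y₁ ∪ {oc}) ∪ X₂` are forests provided `Y₁` does not join `o, c` and `Y₂` does not join `o, c'` (rank-one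
gluing `isForestCfg_union_of_rank_le_one` and free gluing). [cite: Grimmett2006, §3.8 (pp. 61–62); §4.2 Lemma (4.13)] -/
theorem pathGadget_moveGen (hop : o ≠ p) (hoq : o ≠ q) (hpq : p ≠ q)
    (h₁ : ∀ e ∈ E₁, ∀ z ∈ e, z ∈ V₁) (h₂ : ∀ e ∈ E₂, ∀ z ∈ e, z ∈ V₂) (hS : V₁ ∩ V₂ ⊆ ({o, p, q} : Set V))
    (hd : Disjoint E₁ E₂) (hn₁ : ∀ x ∈ ({o, p, q} : Set V), ∀ x' ∈ ({o, p, q} : Set V), s(x, x') ∉ E₁)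
    (hn₂ : ∀ x ∈ ({o, p, q} : Set V), ∀ x' ∈ ({o, p, q} : Set V), s(x, x') ∉ E₂)
    {X Y : BondConfig V} {c c' : V} (hX : IsForestCfg X) (hY : IsForestCfg Y) (hS3' : ({o, c', c} : Set V) = {o, p, q})
    (hoc : o ≠ c) (hoc' : o ≠ c') (hc'c : c' ≠ c) (hc3 : c ∈ ({o, p, q} : Set V)) (hc'3 : c' ∈ ({o, p, q} : Set V))
    (hgES1 : s(o, c) ∈ ({s(o, p), s(o, q)} : Set (Sym2 V))) (hg'ES : s(o, c') ∈ ({s(o, p), s(o, q)} : Set (Sym2 V)))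
    (hX₁d : ∀ x ∈ ({o, p, q} : Set V), ∀ x' ∈ ({o, p, q} : Set V), (openGraph (X ∩ E₁)).Reachable x x' → x = x')
    (hX₂d : ∀ x ∈ ({o, p, q} : Set V), ∀ x' ∈ ({o, p, q} : Set V), (openGraph (X ∩ E₂)).Reachable x x' → x = x')
    (hnY₁ : ¬ (openGraph (Y ∩ E₁)).Reachable o c) (hnY₂ : ¬ (openGraph (Y ∩ E₂)).Reachable o c') :
    IsForestCfg (X ∩ E₁ ∪ {s(o, c')} ∪ Y ∩ E₂) ∧ IsForestCfg (Y ∩ E₁ ∪ {s(o, c)} ∪ X ∩ E₂) := by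
  have ho3 : o ∈ ({o, p, q} : Set V) := mem_insert _ _
  have hp3 : p ∈ ({o, p, q} : Set V) := mem_insert_of_mem _ (mem_insert _ _)
  have hq3 : q ∈ ({o, p, q} : Set V) := mem_insert_of_mem _ (mem_insert_of_mem _ rfl)
  have hESv : ∀ e ∈ ({s(o, p), s(o, q)} : Set (Sym2 V)), ∀ z ∈ e, z ∈ ({o, p, q} : Set V) := by
    intro e he z hz
    rcases he with rfl | he
    · rcases Sym2.mem_iff.1 hz with rfl | rfl
      · exact ho3
      · exact hp3
    · rw [mem_singleton_iff.1 he] at hz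
      rcases Sym2.mem_iff.1 hz with rfl | rfl
      · exact ho3
      · exact hq3
  have hES₂ : Disjoint ({s(o, p), s(o, q)} : Set (Sym2 V)) E₂ := by
    refine Set.disjoint_left.2 fun g hg hg2 => ?_
    rcases hg with rfl | hg
    · exact hn₂ o ho3 p hp3 hg2
    · rw [mem_singleton_iff.1 hg] at hg2; exact hn₂ o ho3 q hq3 hg2
  have hE : ∀ x, x ∈ E₁ → x ∉ E₂ := fun x hx1 hx2 => Set.disjoint_left.1 hd hx1 hx2
  have on₂ : ∀ (X : BondConfig V), ∀ e ∈ X ∩ E₂, ∀ z ∈ e, z ∈ V₂ := fun X e he z hz => h₂ e he.2 z hz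
  have touch : ∀ (X : BondConfig V) (G : Set (Sym2 V)), G ⊆ ({s(o, p), s(o, q)} : Set (Sym2 V)) →
      ∀ e ∈ X ∩ E₁ ∪ G, ∀ z ∈ e, z ∈ V₂ → z ∈ ({o, p, q} : Set V) := by
    rintro X G hG e (he | he) z hz hzV
    · exact hS ⟨h₁ e he.2 z hz, hzV⟩
    · exact hESv e (hG he) z hz
  have disjG : ∀ (X Y : BondConfig V) (G : Set (Sym2 V)), G ⊆ ({s(o, p), s(o, q)} : Set (Sym2 V)) →
      Disjoint (X ∩ E₁ ∪ G) (Y ∩ E₂) := by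
    intro X Y G hG
    refine Set.disjoint_left.2 ?_
    rintro x (hx | hx) ⟨-, hx2⟩
    · exact hE x hx.2 hx2
    · exact Set.disjoint_left.1 hES₂ (hG hx) hx2
  have nS₂ : ∀ (Y : BondConfig V) (x x' : V), x ∈ ({o, p, q} : Set V) → x' ∈ ({o, p, q} : Set V) → s(x, x') ∉ Y ∩ E₂ :=
    fun Y x x' hx hx' h => hn₂ x hx x' hx' h.2
  have nS₁ : ∀ (Y : BondConfig V) (x x' : V), x ∈ ({o, p, q} : Set V) → x' ∈ ({o, p, q} : Set V) → s(x, x') ∉ Y ∩ E₁ :=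
    fun Y x x' hx hx' h => hn₁ x hx x' hx' h.2
  have glueFree : ∀ {U Z : BondConfig V}, (∀ e ∈ U, ∀ z ∈ e, z ∈ V₂ → z ∈ ({o, p, q} : Set V)) → (∀ e ∈ Z, ∀ z ∈ e, z ∈ V₂) →
      Disjoint U Z → s(o, p) ∉ Z → s(o, q) ∉ Z → IsForestCfg U → IsForestCfg Z →
      (∀ x ∈ ({o, p, q} : Set V), ∀ x' ∈ ({o, p, q} : Set V), (openGraph Z).Reachable x x' → x = x') → IsForestCfg (U ∪ Z) :=
    fun hU hZ hUZ h1 h2 hUF hZF hsep => isForestCfg_union_of_sep hop hoq hpq hU hZ hUZ h1 h2 hUF hZF hsep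
  have hX₁F : IsForestCfg (X ∩ E₁) := isForestCfg_of_subset hX inter_subset_left
  have hX₂F : IsForestCfg (X ∩ E₂) := isForestCfg_of_subset hX inter_subset_left
  have hY₁F : IsForestCfg (Y ∩ E₁) := isForestCfg_of_subset hY inter_subset_left
  have hY₂F : IsForestCfg (Y ∩ E₂) := isForestCfg_of_subset hY inter_subset_left
  constructor
  · -- `X₁ ∪ {oc'} ∪ Y₂`: `Y₂` does not join `o, c'` — rank-one gluing with forbidden pair `(o, c')`
    have hU : ∀ e ∈ X ∩ E₁ ∪ {s(o, c')}, ∀ z ∈ e, z ∈ V₂ → z ∈ ({o, c', c} : Set V) := by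
      rw [hS3']; exact touch X {s(o, c')} (singleton_subset_iff.2 hg'ES)
    have hUF : IsForestCfg (X ∩ E₁ ∪ {s(o, c')}) := by
      rw [union_singleton]
      exact (isForestCfg_insert_iff hoc' (nS₁ X o c' ho3 hc'3)).2 ⟨hX₁F, fun h => hoc' (hX₁d o ho3 c' hc'3 h)⟩
    have dX₁ : ∀ (T : Set V), T ⊆ ({o, p, q} : Set V) → ∀ x ∈ T, ∀ x' ∈ T, (openGraph (X ∩ E₁)).Reachable x x' → x = x' :=
      fun T hT x hx x' hx' hxx' => hX₁d x (hT hx) x' (hT hx') hxx'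
    have hT1 : ({o, c, c'} : Set V) ⊆ ({o, p, q} : Set V) := by rw [Set.pair_comm]; exact hS3'.le
    have hT2 : ({c', o, c} : Set V) ⊆ ({o, p, q} : Set V) := by rw [insert_comm]; exact hS3'.le
    refine isForestCfg_union_of_rank_le_one hoc' hoc hc'c hU (on₂ Y) (disjG X Y {s(o, c')} (singleton_subset_iff.2 hg'ES))
      (nS₂ _ o c' ho3 hc'3) (nS₂ _ o c ho3 hc3) (nS₂ _ c' c hc'3 hc3) hUF hY₂F hnY₂ (fun _ => ⟨?_, ?_⟩) (fun _ => ⟨?_, ?_⟩)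
    · rintro (h | h)
      · exact hn₁ o ho3 c hc3 h.2
      · rcases Sym2.eq_iff.1 (mem_singleton_iff.1 h) with ⟨-, h2⟩ | ⟨h1, -⟩
        · exact hc'c h2.symm
        · exact hoc' h1
    · have : insert (s(o, c)) (X ∩ E₁ ∪ {s(o, c')}) = ({s(o, c), s(o, c')} : Set (Sym2 V)) ∪ X ∩ E₁ := by
        rw [union_singleton, insert_union, singleton_union]
      rw [this]
      exact (isForestCfg_pairPath_union_iff hoc hoc' hc'c.symm (nS₁ X o c ho3 hc3) (nS₁ X o c' ho3 hc'3)).2 ⟨hX₁F, dX₁ _ hT1⟩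
    · rintro (h | h)
      · exact hn₁ c' hc'3 c hc3 h.2
      · rcases Sym2.eq_iff.1 (mem_singleton_iff.1 h) with ⟨h1, -⟩ | ⟨-, h2⟩
        · exact hoc' h1.symm
        · exact hoc h2.symm
    · have : insert (s(c', c)) (X ∩ E₁ ∪ {s(o, c')}) = ({s(c', o), s(c', c)} : Set (Sym2 V)) ∪ X ∩ E₁ := by
        rw [union_singleton, insert_union, singleton_union, insert_comm, Sym2.eq_swap (a := o)]
      rw [this]
      exact (isForestCfg_pairPath_union_iff hoc'.symm hc'c hoc (by rw [Sym2.eq_swap]; exact nS₁ X o c' ho3 hc'3)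
        (nS₁ X c' c hc'3 hc3)).2 ⟨hX₁F, dX₁ _ hT2⟩
  · -- `Y₁ ∪ {oc} ∪ X₂`, `X₂` discrete: free gluing
    have hUF : IsForestCfg (Y ∩ E₁ ∪ {s(o, c)}) := by
      rw [union_singleton]
      exact (isForestCfg_insert_iff hoc (nS₁ _ o c ho3 hc3)).2 ⟨hY₁F, hnY₁⟩
    exact glueFree (touch Y {s(o, c)} (singleton_subset_iff.2 hgES1)) (on₂ X) (disjG Y X {s(o, c)} (singleton_subset_iff.2 hgES1))
      (nS₂ _ o p ho3 hp3) (nS₂ _ o q ho3 hq3) hUF hX₂F hX₂d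

/-- **Give the whole path to the class `X`** (`X₁` and `Y₂` discrete on `S`): `(X₁ ∪ {op, oq}) ∪ Y₂` is a forest (path on a discrete
side glued freely), and `Y₁ ∪ X₂` is a forest provided `X₂` does not join `o, c`, `Y₁` does not join `o, c'`, and `c, c'` are not joined
in both (rank-one gluing). [cite: Grimmett2006, §3.8 (pp. 61–62); §4.2 Lemma (4.13)] -/
theorem pathGadget_moveFull (hop : o ≠ p) (hoq : o ≠ q) (hpq : p ≠ q)
    (h₁ : ∀ e ∈ E₁, ∀ z ∈ e, z ∈ V₁) (h₂ : ∀ e ∈ E₂, ∀ z ∈ e, z ∈ V₂) (hS : V₁ ∩ V₂ ⊆ ({o, p, q} : Set V))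
    (hd : Disjoint E₁ E₂) (hn₁ : ∀ x ∈ ({o, p, q} : Set V), ∀ x' ∈ ({o, p, q} : Set V), s(x, x') ∉ E₁)
    (hn₂ : ∀ x ∈ ({o, p, q} : Set V), ∀ x' ∈ ({o, p, q} : Set V), s(x, x') ∉ E₂)
    {X Y : BondConfig V} {c c' : V} (hX : IsForestCfg X) (hY : IsForestCfg Y) (hS3' : ({o, c, c'} : Set V) = {o, p, q})
    (hoc : o ≠ c) (hoc' : o ≠ c') (hcc' : c ≠ c') (hc3 : c ∈ ({o, p, q} : Set V)) (hc'3 : c' ∈ ({o, p, q} : Set V))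
    (hX₁d : ∀ x ∈ ({o, p, q} : Set V), ∀ x' ∈ ({o, p, q} : Set V), (openGraph (X ∩ E₁)).Reachable x x' → x = x')
    (hY₂d : ∀ x ∈ ({o, p, q} : Set V), ∀ x' ∈ ({o, p, q} : Set V), (openGraph (Y ∩ E₂)).Reachable x x' → x = x')
    (hnX₂ : ¬ (openGraph (X ∩ E₂)).Reachable o c) (hnY₁ : ¬ (openGraph (Y ∩ E₁)).Reachable o c')
    (hncc' : ¬ ((openGraph (X ∩ E₂)).Reachable c c' ∧ (openGraph (Y ∩ E₁)).Reachable c c')) :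
    IsForestCfg (X ∩ E₁ ∪ ({s(o, p), s(o, q)} : Set (Sym2 V)) ∪ Y ∩ E₂) ∧ IsForestCfg (Y ∩ E₁ ∪ ∅ ∪ X ∩ E₂) := by
  have ho3 : o ∈ ({o, p, q} : Set V) := mem_insert _ _
  have hp3 : p ∈ ({o, p, q} : Set V) := mem_insert_of_mem _ (mem_insert _ _)
  have hq3 : q ∈ ({o, p, q} : Set V) := mem_insert_of_mem _ (mem_insert_of_mem _ rfl)
  have hESv : ∀ e ∈ ({s(o, p), s(o, q)} : Set (Sym2 V)), ∀ z ∈ e, z ∈ ({o, p, q} : Set V) := by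
    intro e he z hz
    rcases he with rfl | he
    · rcases Sym2.mem_iff.1 hz with rfl | rfl
      · exact ho3
      · exact hp3
    · rw [mem_singleton_iff.1 he] at hz
      rcases Sym2.mem_iff.1 hz with rfl | rfl
      · exact ho3
      · exact hq3
  have hES₂ : Disjoint ({s(o, p), s(o, q)} : Set (Sym2 V)) E₂ := by
    refine Set.disjoint_left.2 fun g hg hg2 => ?_
    rcases hg with rfl | hg
    · exact hn₂ o ho3 p hp3 hg2
    · rw [mem_singleton_iff.1 hg] at hg2; exact hn₂ o ho3 q hq3 hg2
  have hE : ∀ x, x ∈ E₁ → x ∉ E₂ := fun x hx1 hx2 => Set.disjoint_left.1 hd hx1 hx2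
  have on₂ : ∀ (X : BondConfig V), ∀ e ∈ X ∩ E₂, ∀ z ∈ e, z ∈ V₂ := fun X e he z hz => h₂ e he.2 z hz
  have touch : ∀ (X : BondConfig V) (G : Set (Sym2 V)), G ⊆ ({s(o, p), s(o, q)} : Set (Sym2 V)) →
      ∀ e ∈ X ∩ E₁ ∪ G, ∀ z ∈ e, z ∈ V₂ → z ∈ ({o, p, q} : Set V) := by
    rintro X G hG e (he | he) z hz hzV
    · exact hS ⟨h₁ e he.2 z hz, hzV⟩
    · exact hESv e (hG he) z hz
  have disjG : ∀ (X Y : BondConfig V) (G : Set (Sym2 V)), G ⊆ ({s(o, p), s(o, q)} : Set (Sym2 V)) →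
      Disjoint (X ∩ E₁ ∪ G) (Y ∩ E₂) := by
    intro X Y G hG
    refine Set.disjoint_left.2 ?_
    rintro x (hx | hx) ⟨-, hx2⟩
    · exact hE x hx.2 hx2
    · exact Set.disjoint_left.1 hES₂ (hG hx) hx2
  have nS₂ : ∀ (Y : BondConfig V) (x x' : V), x ∈ ({o, p, q} : Set V) → x' ∈ ({o, p, q} : Set V) → s(x, x') ∉ Y ∩ E₂ :=
    fun Y x x' hx hx' h => hn₂ x hx x' hx' h.2
  have nS₁ : ∀ (Y : BondConfig V) (x x' : V), x ∈ ({o, p, q} : Set V) → x' ∈ ({o, p, q} : Set V) → s(x, x') ∉ Y ∩ E₁ :=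
    fun Y x x' hx hx' h => hn₁ x hx x' hx' h.2
  have glueFree : ∀ {U Z : BondConfig V}, (∀ e ∈ U, ∀ z ∈ e, z ∈ V₂ → z ∈ ({o, p, q} : Set V)) → (∀ e ∈ Z, ∀ z ∈ e, z ∈ V₂) →
      Disjoint U Z → s(o, p) ∉ Z → s(o, q) ∉ Z → IsForestCfg U → IsForestCfg Z →
      (∀ x ∈ ({o, p, q} : Set V), ∀ x' ∈ ({o, p, q} : Set V), (openGraph Z).Reachable x x' → x = x') → IsForestCfg (U ∪ Z) :=
    fun hU hZ hUZ h1 h2 hUF hZF hsep => isForestCfg_union_of_sep hop hoq hpq hU hZ hUZ h1 h2 hUF hZF hsep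
  have hX₁F : IsForestCfg (X ∩ E₁) := isForestCfg_of_subset hX inter_subset_left
  have hX₂F : IsForestCfg (X ∩ E₂) := isForestCfg_of_subset hX inter_subset_left
  have hY₁F : IsForestCfg (Y ∩ E₁) := isForestCfg_of_subset hY inter_subset_left
  have hY₂F : IsForestCfg (Y ∩ E₂) := isForestCfg_of_subset hY inter_subset_left
  constructor
  · -- `X₁ ∪ {op, oq} ∪ Y₂`: path on a discrete side, glued freely onto a discrete side
    have hUF : IsForestCfg (X ∩ E₁ ∪ ({s(o, p), s(o, q)} : Set (Sym2 V))) := by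
      rw [union_comm]
      exact (isForestCfg_pairPath_union_iff hop hoq hpq (nS₁ X o p ho3 hp3) (nS₁ X o q ho3 hq3)).2 ⟨hX₁F, hX₁d⟩
    exact glueFree (touch X ({s(o, p), s(o, q)} : Set (Sym2 V)) subset_rfl) (on₂ Y) (disjG X Y ({s(o, p), s(o, q)} : Set (Sym2 V)) subset_rfl) (nS₂ _ o p ho3 hp3) (nS₂ _ o q ho3 hq3)
      hUF hY₂F hY₂d
  · -- `Y₁ ∪ X₂`: rank-one gluing, forbidden pair `(o, c)`
    rw [union_empty]
    have hU : ∀ e ∈ Y ∩ E₁ ∪ (∅ : Set (Sym2 V)), ∀ z ∈ e, z ∈ V₂ → z ∈ ({o, c, c'} : Set V) := by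
      rw [hS3']; exact touch Y ∅ (empty_subset _)
    rw [union_empty] at hU
    refine isForestCfg_union_of_rank_le_one hoc hoc' hcc' hU (on₂ X)
      (Set.disjoint_of_subset inter_subset_right inter_subset_right hd) (nS₂ _ o c ho3 hc3) (nS₂ _ o c' ho3 hc'3)
      (nS₂ _ c c' hc3 hc'3) hY₁F hX₂F hnX₂ (fun _ => ⟨nS₁ _ o c' ho3 hc'3, ?_⟩) (fun hcc => ⟨nS₁ _ c c' hc3 hc'3, ?_⟩)
    · exact (isForestCfg_insert_iff hoc' (nS₁ _ o c' ho3 hc'3)).2 ⟨hY₁F, hnY₁⟩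
    · exact (isForestCfg_insert_iff hcc' (nS₁ _ c c' hc3 hc'3)).2 ⟨hY₁F, fun h => hncc' ⟨hcc, h⟩⟩

end PathGadgetMoves

end FK

end Summit.CriticalPhenomena.PercolationContinuityZ3.Theorems

end
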